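import Literature.Topology.FourManifolds.FlowerDomainPolar
import Literature.Topology.FourManifolds.ThickenedPlanarHandlebody
import Mathlib.AlgebraicTopology.FundamentalGroupoid.SimplyConnected
import Mathlib.Analysis.Convex.Contractible
import HarnessLib

/-!
# The valley arcs of the flower surface

Topic `Literature/Topology/FourManifolds`; fact seat
`provefact-Literature.Topology.FourManifolds.exists-cbed50d78a` (named fact (g′)
`Literature.Topology.FourManifolds.exists_marking_centralSurface_of_gkTrisection`), sequel of
`FlowerHandlebody.lean` / `FlowerDomainPolar.lean`.  The flower surface
`Z = {q_g(x,y) + z² = c_g}` is cut into its `g` congruent sectors by the **valley arcs**: the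
parts of `Z` over the valley rays `θ = (2j+1)π/g`, each an arc from the upper pole
`0⁺ = (0, 0, √c)` (`FlowerModel.top`) to the lower pole `0⁻` (`FlowerModel.bot`) through the tip
`(pol ρ₄ ((2j+1)π/g), 0)`.  This file treats the arc over `θ = π/g` (the others are its images
under the rotations `rot3 (ζ^j)` of `FlowerSymmetry.lean`):

* `FlowerModel.vArcFun`, `FlowerModel.vArc : Path (top g) (bot g)` — the explicit
  parametrisation (up the upper sheet `r ↦ (pol r (π/g), √(c - vprof r))`, `0 ≤ r ≤ ρ₄`, then
  down the lower sheet), continuous (the two halves agree at the tip, where the height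
  `√(c - vprof ρ₄)` vanishes) and **injective** (`injective_vArc`: heights have opposite signs on
  the two halves and vanish only at the tip; radii distinguish points within a half);
* `range_vArc : range (vArc hg) = vArcSet g hg`, the part of `Z` over the valley ray segment
  `{pol r (π/g) : 0 ≤ r ≤ ρ₄}`;
* consequences: the valley arc is simply connected (`isSimplyConnected_vArcSet`: an injective
  path of a Hausdorff space is an embedded interval), compact, path connected, and contains both
  poles (`top_ne_bot`).

These are the van Kampen inputs "the pieces meet in an arc" (trivial `π₁`) and, for two valley
arcs, "in a circle" (`BallWithArcsBasis.exists_mulEquiv_int_apply_two_arcs`).  Everything is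
proved; no named facts.

## References

* A. Hatcher, *Algebraic Topology*, CUP (2002), §1.2 (Seifert–van Kampen), p. 51. [HatcherAT2002]
* D. Gay, R. Kirby, *Trisecting 4-manifolds*, Geom. Topol. 20 (2016), Def. 1, Remark 2.
  [GayKirby2016]
-/

open scoped Manifold ContDiff Topology InnerProductSpace Real unitInterval
open Set Function Filter Metric Module Complex

noncomputable section

namespace Literature.Topology.FourManifolds

/-- Local notation: `𝔼 n` is the model Euclidean space `EuclideanSpace ℝ (Fin n)`. -/
local notation "𝔼 " n:arg => EuclideanSpace ℝ (Fin n)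

open PlanarThickening

namespace FlowerModel

variable {g : ℕ}

/-! ### §1 The two poles -/

/-- **The upper pole** `0⁺ = (0, 0, √c)` of the flower surface. [folklore] -/
def top (g : ℕ) : 𝔼 3 := lift 0 + Real.sqrt (level g) • ez

/-- **The lower pole** `0⁻ = (0, 0, -√c)`. [folklore] -/
def bot (g : ℕ) : 𝔼 3 := lift 0 + (-Real.sqrt (level g)) • ez

/-- The upper pole lies on the flower surface. [folklore] -/
theorem thicken_top (hg : 1 ≤ g) : thicken (flower g) (top g) = level g := by
  rw [top, thicken_apply, map_add, map_smul, proj_lift, proj_ez, smul_zero, add_zero, flower_zero hg]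
  simp [Real.sq_sqrt (level_pos hg).le]

/-- The lower pole lies on the flower surface. [folklore] -/
theorem thicken_bot (hg : 1 ≤ g) : thicken (flower g) (bot g) = level g := by
  rw [bot, thicken_apply, map_add, map_smul, proj_lift, proj_ez, smul_zero, add_zero, flower_zero hg]
  simp [Real.sq_sqrt (level_pos hg).le]

/-- The poles are distinct. [folklore] -/
theorem top_ne_bot (hg : 1 ≤ g) : top g ≠ bot g := by
  intro h
  have := congrArg (fun p : 𝔼 3 => p 2) h
  simp only [top, bot] at this
  have hs : 0 < Real.sqrt (level g) := Real.sqrt_pos.2 (level_pos hg)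
  simp at this
  linarith

/-! ### §2 The valley arc over the ray `θ = π/g` -/

/-- The height over the valley ray: `√(c - vprof r)`. [folklore] -/
def vHt (g : ℕ) (r : ℝ) : ℝ := Real.sqrt (level g - vprof g r)

/-- The height is continuous. [folklore] -/
theorem continuous_vHt (hg : 1 ≤ g) : Continuous (vHt g) := by
  unfold vHt
  have : Continuous (vprof g) := continuous_iff_continuousAt.2 fun r => (hasDerivAt_vprof hg r).continuousAt
  fun_prop

/-- The height vanishes exactly at `ρ₄` (on `[0, ∞)`). [folklore] -/
theorem vHt_eq_zero_iff (hg : 2 ≤ g) {r : ℝ} (hr : 0 ≤ r) (hr' : r ≤ rho4 hg) : vHt g r = 0 ↔ r = rho4 hg := by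
  rw [vHt, Real.sqrt_eq_zero (by linarith [(vprof_le_level_iff hg hr).2 hr']), sub_eq_zero, eq_comm]
  exact vprof_eq_level_iff hg hr

/-- The height at `ρ₄` is `0`. [folklore] -/
theorem vHt_rho4 (hg : 2 ≤ g) : vHt g (rho4 hg) = 0 := (vHt_eq_zero_iff hg (rho4_pos hg).le le_rfl).2 rfl

/-- The height at `0` is `√c`. [folklore] -/
theorem vHt_zero (hg : 1 ≤ g) : vHt g 0 = Real.sqrt (level g) := by
  rw [vHt, vprof, V_zero hg]; simp

/-- The height is non-negative. [folklore] -/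
theorem vHt_nonneg (r : ℝ) : 0 ≤ vHt g r := Real.sqrt_nonneg _

/-- The height is positive before `ρ₄`. [folklore] -/
theorem vHt_pos (hg : 2 ≤ g) {r : ℝ} (hr : 0 ≤ r) (hr' : r < rho4 hg) : 0 < vHt g r :=
  lt_of_le_of_ne (vHt_nonneg r) fun h => hr'.ne ((vHt_eq_zero_iff hg hr hr'.le).1 h.symm)

/-- `vHt² = c - vprof` on `[0, ρ₄]`. [folklore] -/
theorem vHt_sq (hg : 2 ≤ g) {r : ℝ} (hr : 0 ≤ r) (hr' : r ≤ rho4 hg) : vHt g r ^ 2 = level g - vprof g r :=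
  Real.sq_sqrt (by linarith [(vprof_le_level_iff hg hr).2 hr'])

/-- **The valley arc, parametrised by `[0, 2ρ₄]`**: up the upper sheet over the valley ray from the
upper pole to the tip `T = (pol ρ₄ (π/g), 0)`, then down the lower sheet to the lower pole. [folklore] -/
def vArcFun (hg : 2 ≤ g) (s : ℝ) : 𝔼 3 :=
  if s ≤ rho4 hg then lift (pol s (π / g)) + vHt g s • ez
  else lift (pol (2 * rho4 hg - s) (π / g)) + (-vHt g (2 * rho4 hg - s)) • ez

/-- The valley arc function on `(-∞, ρ₄]`. [folklore] -/
theorem vArcFun_of_le (hg : 2 ≤ g) {s : ℝ} (hs : s ≤ rho4 hg) :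
    vArcFun hg s = lift (pol s (π / g)) + vHt g s • ez := by rw [vArcFun, if_pos hs]

/-- The valley arc function on `(ρ₄, ∞)`. [folklore] -/
theorem vArcFun_of_lt (hg : 2 ≤ g) {s : ℝ} (hs : rho4 hg < s) :
    vArcFun hg s = lift (pol (2 * rho4 hg - s) (π / g)) + (-vHt g (2 * rho4 hg - s)) • ez := by
  rw [vArcFun, if_neg (not_le.2 hs)]

/-- The valley arc function on `[ρ₄, ∞)` (the two formulas agree at `ρ₄`). [folklore] -/
theorem vArcFun_of_ge (hg : 2 ≤ g) {s : ℝ} (hs : rho4 hg ≤ s) :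
    vArcFun hg s = lift (pol (2 * rho4 hg - s) (π / g)) + (-vHt g (2 * rho4 hg - s)) • ez := by
  rcases hs.eq_or_lt with h | h
  · rw [← h, vArcFun_of_le hg le_rfl, show 2 * rho4 hg - rho4 hg = rho4 hg by ring, vHt_rho4 hg, neg_zero]
  · exact vArcFun_of_lt hg h

/-- The valley arc function is continuous (pasting the two closed half-lines). [folklore] -/
theorem continuous_vArcFun (hg : 2 ≤ g) : Continuous (vArcFun hg) := by
  have hg1 : 1 ≤ g := by omega
  have hpol : Continuous fun s : ℝ => pol s (π / g) := by
    show Continuous ((fun x : ℝ × ℝ => pol x.1 x.2) ∘ fun s : ℝ => (s, π / g))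
    exact continuous_pol.comp (continuous_id.prodMk continuous_const)
  have hpol' : Continuous fun s : ℝ => pol (2 * rho4 hg - s) (π / g) := by
    show Continuous ((fun x : ℝ × ℝ => pol x.1 x.2) ∘ fun s : ℝ => (2 * rho4 hg - s, π / g))
    exact continuous_pol.comp ((continuous_const.sub continuous_id).prodMk continuous_const)
  have h1 : Continuous fun s : ℝ => lift (pol s (π / g)) + vHt g s • ez :=
    (lift.continuous.comp hpol).add ((continuous_vHt hg1).smul continuous_const)
  have h2 : Continuous fun s : ℝ => lift (pol (2 * rho4 hg - s) (π / g)) + (-vHt g (2 * rho4 hg - s)) • ez :=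
    (lift.continuous.comp hpol').add
      (((continuous_vHt hg1).comp (continuous_const.sub continuous_id)).neg.smul continuous_const)
  have hcover : (Iic (rho4 hg) ∪ Ici (rho4 hg) : Set ℝ) = univ := Iic_union_Ici
  rw [← continuousOn_univ, ← hcover]
  refine ContinuousOn.union_of_isClosed (h1.continuousOn.congr fun s hs => vArcFun_of_le hg hs)
    (h2.continuousOn.congr fun s hs => vArcFun_of_ge hg hs) isClosed_Iic isClosed_Ici

/-- The projection of the valley arc, first half. [folklore] -/
theorem proj_vArcFun_of_le (hg : 2 ≤ g) {s : ℝ} (hs : s ≤ rho4 hg) : proj (vArcFun hg s) = pol s (π / g) := by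
  rw [vArcFun_of_le hg hs, map_add, map_smul, proj_lift, proj_ez, smul_zero, add_zero]

/-- The projection of the valley arc, second half. [folklore] -/
theorem proj_vArcFun_of_lt (hg : 2 ≤ g) {s : ℝ} (hs : rho4 hg < s) :
    proj (vArcFun hg s) = pol (2 * rho4 hg - s) (π / g) := by
  rw [vArcFun_of_lt hg hs, map_add, map_smul, proj_lift, proj_ez, smul_zero, add_zero]

/-- The height of the valley arc, first half. [folklore] -/
theorem vArcFun_apply_two_of_le (hg : 2 ≤ g) {s : ℝ} (hs : s ≤ rho4 hg) : vArcFun hg s 2 = vHt g s := by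
  rw [vArcFun_of_le hg hs]; simp

/-- The height of the valley arc, second half. [folklore] -/
theorem vArcFun_apply_two_of_lt (hg : 2 ≤ g) {s : ℝ} (hs : rho4 hg < s) :
    vArcFun hg s 2 = -vHt g (2 * rho4 hg - s) := by
  rw [vArcFun_of_lt hg hs]; simp

/-- The valley arc starts at the upper pole. [folklore] -/
theorem vArcFun_zero (hg : 2 ≤ g) : vArcFun hg 0 = top g := by
  rw [vArcFun_of_le hg (rho4_pos hg).le, pol_zero_left, vHt_zero (by omega), top]

/-- The valley arc ends at the lower pole. [folklore] -/
theorem vArcFun_two_mul (hg : 2 ≤ g) : vArcFun hg (2 * rho4 hg) = bot g := by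
  rw [vArcFun_of_lt hg (by linarith [rho4_pos hg]), show 2 * rho4 hg - 2 * rho4 hg = 0 by ring, pol_zero_left,
    vHt_zero (by omega), bot]

/-- **The valley arc lies on the flower surface.** [folklore] -/
theorem thicken_vArcFun (hg : 2 ≤ g) {s : ℝ} (hs0 : 0 ≤ s) (hs : s ≤ 2 * rho4 hg) :
    thicken (flower g) (vArcFun hg s) = level g := by
  have hg1 : 1 ≤ g := by omega
  rcases le_or_gt s (rho4 hg) with h | h
  · rw [thicken_apply, proj_vArcFun_of_le hg h, vArcFun_apply_two_of_le hg h, flower_pol_valley hg1,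
      vHt_sq hg hs0 h]
    ring
  · rw [thicken_apply, proj_vArcFun_of_lt hg h, vArcFun_apply_two_of_lt hg h, flower_pol_valley hg1, neg_sq,
      vHt_sq hg (by linarith) (by linarith)]
    ring

/-- **The valley arc function is injective on `[0, 2ρ₄]`.** [folklore] -/
theorem injOn_vArcFun (hg : 2 ≤ g) : InjOn (vArcFun hg) (Icc 0 (2 * rho4 hg)) := by
  have hg1 : 1 ≤ g := by omega
  intro s hs s' hs' h
  -- compare heights and radii
  have h2 := congrArg (fun p : 𝔼 3 => p 2) h
  have hπ := congrArg (fun p : 𝔼 3 => ‖proj p‖) h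
  simp only at h2 hπ
  rcases le_or_gt s (rho4 hg) with h₁ | h₁ <;> rcases le_or_gt s' (rho4 hg) with h₂ | h₂
  · rw [proj_vArcFun_of_le hg h₁, proj_vArcFun_of_le hg h₂, norm_pol, norm_pol, abs_of_nonneg hs.1,
      abs_of_nonneg hs'.1] at hπ
    exact hπ
  · -- `s ≤ ρ₄ < s'`: heights `≥ 0` and `≤ 0`, so both vanish
    rw [vArcFun_apply_two_of_le hg h₁, vArcFun_apply_two_of_lt hg h₂] at h2
    have ha := vHt_nonneg (g := g) s
    have hb := vHt_nonneg (g := g) (2 * rho4 hg - s')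
    have hzero : vHt g s = 0 := by linarith
    have hzero' : vHt g (2 * rho4 hg - s') = 0 := by linarith
    rw [vHt_eq_zero_iff hg hs.1 h₁] at hzero
    rw [vHt_eq_zero_iff hg (by linarith [hs'.2]) (by linarith)] at hzero'
    linarith
  · rw [vArcFun_apply_two_of_lt hg h₁, vArcFun_apply_two_of_le hg h₂] at h2
    have ha := vHt_nonneg (g := g) s'
    have hb := vHt_nonneg (g := g) (2 * rho4 hg - s)
    have hzero : vHt g s' = 0 := by linarith
    have hzero' : vHt g (2 * rho4 hg - s) = 0 := by linarith
    rw [vHt_eq_zero_iff hg hs'.1 h₂] at hzero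
    rw [vHt_eq_zero_iff hg (by linarith [hs.2]) (by linarith)] at hzero'
    linarith
  · rw [proj_vArcFun_of_lt hg h₁, proj_vArcFun_of_lt hg h₂, norm_pol, norm_pol,
      abs_of_nonneg (by linarith [hs.2]), abs_of_nonneg (by linarith [hs'.2])] at hπ
    linarith

/-- **The valley arc as a path** from the upper pole to the lower pole. [folklore] -/
def vArc (hg : 2 ≤ g) : Path (top g) (bot g) where
  toFun t := vArcFun hg (2 * rho4 hg * t)
  continuous_toFun := (continuous_vArcFun hg).comp (continuous_const.mul continuous_subtype_val)
  source' := by simp [vArcFun_zero hg]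
  target' := by simp [vArcFun_two_mul hg]

/-- The valley arc path, evaluated. [folklore] -/
theorem vArc_apply (hg : 2 ≤ g) (t : I) : vArc hg t = vArcFun hg (2 * rho4 hg * t) := rfl

/-- **The valley arc path is injective.** [folklore] -/
theorem injective_vArc (hg : 2 ≤ g) : Injective (vArc hg) := by
  intro t t' h
  have h4 : 0 < 2 * rho4 hg := by linarith [rho4_pos hg]
  have hmem : ∀ u : I, 2 * rho4 hg * (u : ℝ) ∈ Icc 0 (2 * rho4 hg) := fun u =>
    ⟨mul_nonneg h4.le u.2.1, mul_le_of_le_one_right h4.le u.2.2⟩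
  have := injOn_vArcFun hg (hmem t) (hmem t') h
  exact Subtype.ext (mul_left_cancel₀ h4.ne' this)

/-- Every point of the valley arc lies on the flower surface. [folklore] -/
theorem thicken_vArc (hg : 2 ≤ g) (t : I) : thicken (flower g) (vArc hg t) = level g := by
  have h4 : 0 < 2 * rho4 hg := by linarith [rho4_pos hg]
  exact thicken_vArcFun hg (mul_nonneg h4.le t.2.1) (mul_le_of_le_one_right h4.le t.2.2)

variable (g) in
/-- **The valley arc as a set**: the part of the flower surface over the valley ray segment
`{pol r (π/g) : 0 ≤ r ≤ ρ₄}`. [folklore] -/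
def vArcSet (hg : 2 ≤ g) : Set (𝔼 3) :=
  {p | thicken (flower g) p = level g} ∩ proj ⁻¹' ((fun r => pol r (π / g)) '' Icc 0 (rho4 hg))

/-- **The range of the valley arc path is the valley arc set.** [folklore] -/
theorem range_vArc (hg : 2 ≤ g) : range (vArc hg) = vArcSet g hg := by
  have hg1 : 1 ≤ g := by omega
  have h4 : 0 < 2 * rho4 hg := by linarith [rho4_pos hg]
  apply Subset.antisymm
  · rintro p ⟨t, rfl⟩
    refine ⟨thicken_vArc hg t, ?_⟩
    show proj (vArcFun hg (2 * rho4 hg * t)) ∈ (fun r => pol r (π / g)) '' Icc 0 (rho4 hg)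
    rcases le_or_gt (2 * rho4 hg * (t : ℝ)) (rho4 hg) with h | h
    · rw [proj_vArcFun_of_le hg h]
      exact ⟨_, ⟨mul_nonneg h4.le t.2.1, h⟩, rfl⟩
    · rw [proj_vArcFun_of_lt hg h]
      refine ⟨_, ⟨?_, by linarith⟩, rfl⟩
      have := mul_le_of_le_one_right h4.le t.2.2
      linarith
  · rintro p ⟨hq, ⟨r, ⟨hr0, hr⟩, hpr⟩⟩
    -- the height of `p` is `± vHt r`
    have hq' : flower g (proj p) + p 2 ^ 2 = level g := hq
    rw [← hpr, flower_pol_valley hg1] at hq'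
    have hsq : p 2 ^ 2 = vHt g r ^ 2 := by rw [vHt_sq hg hr0 hr]; linarith
    have hp : lift (proj p) + p 2 • ez = p := lift_proj_add p
    rw [← hpr] at hp
    rcases sq_eq_sq_iff_eq_or_eq_neg.1 hsq with h2 | h2
    · -- upper sheet: parameter `r`
      refine ⟨⟨r / (2 * rho4 hg), ⟨div_nonneg hr0 h4.le, (div_le_one h4).2 (by linarith)⟩⟩, ?_⟩
      rw [vArc_apply]
      show vArcFun hg (2 * rho4 hg * (r / (2 * rho4 hg))) = p
      rw [mul_div_cancel₀ _ h4.ne', vArcFun_of_le hg hr, ← hp, h2]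
    · -- lower sheet: parameter `2ρ₄ - r`
      refine ⟨⟨(2 * rho4 hg - r) / (2 * rho4 hg), ⟨div_nonneg (by linarith) h4.le,
        (div_le_one h4).2 (by linarith)⟩⟩, ?_⟩
      rw [vArc_apply]
      show vArcFun hg (2 * rho4 hg * ((2 * rho4 hg - r) / (2 * rho4 hg))) = p
      rw [mul_div_cancel₀ _ h4.ne', vArcFun_of_ge hg (by linarith), show 2 * rho4 hg - (2 * rho4 hg - r) = r by ring,
        ← hp, h2]

/-- **The valley arc is simply connected** (an injective path of a Hausdorff space is an embedded
interval). [folklore] -/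
theorem isSimplyConnected_vArcSet (hg : 2 ≤ g) : IsSimplyConnected (vArcSet g hg) := by
  rw [← range_vArc hg, ← image_univ]
  have hce : Topology.IsClosedEmbedding (vArc hg) := (vArc hg).continuous.isClosedEmbedding (injective_vArc hg)
  rw [hce.isEmbedding.isSimplyConnected_image]
  change SimplyConnectedSpace (univ : Set I)
  haveI : ContractibleSpace I := (convex_Icc (0:ℝ) 1).contractibleSpace ⟨0, left_mem_Icc.2 zero_le_one⟩
  haveI : SimplyConnectedSpace I := SimplyConnectedSpace.ofContractible I
  exact (Homeomorph.Set.univ I).toHomotopyEquiv.simplyConnectedSpace_iff.2 inferInstance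

/-- The valley arc set is compact. [folklore] -/
theorem isCompact_vArcSet (hg : 2 ≤ g) : IsCompact (vArcSet g hg) := by
  rw [← range_vArc hg]; exact isCompact_range (vArc hg).continuous

/-- The valley arc set is path connected. [folklore] -/
theorem isPathConnected_vArcSet (hg : 2 ≤ g) : IsPathConnected (vArcSet g hg) := by
  haveI : ContractibleSpace I := (convex_Icc (0:ℝ) 1).contractibleSpace ⟨0, left_mem_Icc.2 zero_le_one⟩
  haveI : SimplyConnectedSpace I := SimplyConnectedSpace.ofContractible I
  rw [← range_vArc hg]; exact isPathConnected_range (vArc hg).continuous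

/-- The poles lie on the valley arc. [folklore] -/
theorem top_mem_vArcSet (hg : 2 ≤ g) : top g ∈ vArcSet g hg := by
  rw [← range_vArc hg]; exact ⟨0, (vArc hg).source⟩

/-- The poles lie on the valley arc. [folklore] -/
theorem bot_mem_vArcSet (hg : 2 ≤ g) : bot g ∈ vArcSet g hg := by
  rw [← range_vArc hg]; exact ⟨1, (vArc hg).target⟩

end FlowerModel

end Literature.Topology.FourManifolds
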